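import Summits.ABC.IUTFork.MLFGaloisStronglyCompleteUnconditional
import Literature.AlgebraicGeometry.Frobenioids.ProfiniteUnitsTopologyUniqueStrength
import HarnessLib

/-!
# The Krull topology of `Gal(k̄/k)` (`k/ℚ_p` finite) is its ONLY topologically-finitely-generated
# profinite group topology — [FrdI] Def. 2.8 (i) «[uniquely determined]» AT `G_k`, unconditionally

Cell `abc-iut` (run/shared/lean/pub/abc-iut/), FACT-LIST row F-1275
(`Literature.AlgebraicGeometry.Frobenioids.TfgProfiniteTopologyUnique`, Mochizuki, *The geometry of
Frobenioids I* (2008), Def. 2.8 (i), kurims p. 52 [cite: MochizukiFrdI2008, Def. 2.8(i) p.52]: «O×(A) admits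
a [uniquely determined] profinite topology such that O×(A), equipped with this topology, is a topologically
finitely generated profinite [abelian] group»).  The named statement `TfgProfiniteTopologyUnique M` («any two
topologically finitely generated profinite group topologies on the group `M` coincide») is PROVED in the tree for
abelian `M` (the printed `O×(A)`), for finite groups and for (virtually) pro-`p` groups, and for an arbitrary group
it is the rigidity corollary of Nikolov–Segal (`TfgProfiniteTopologyUnique.forall_iff_forall_continuous_mulEquiv`,
conditional closer `….forall_of_nikolovSegalStatement`).  This PROOF-ONLY file adds the instance class that
inter-universal Teichmüller theory actually meets beside `O×`: the absolute Galois group `Γ_k = Gal(k̄/k)` of a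
non-archimedean local field `k` of characteristic `0`, UNCONDITIONALLY — by the bridge
`TfgProfiniteTopologyUnique.of_forall_finiteIndex_isOpen` from the tree's unconditional theorems «`Γ_k` is
topologically finitely generated» (`isTopologicallyFinitelyGenerated_absoluteGaloisGroup_local`, [NSW] Thm 7.5.10
via Tate's local Euler–Poincaré characteristic) and «every finite-index subgroup of `Γ_k` is open»
(`forall_finiteIndex_isOpen_absoluteGaloisGroup`, the `G_k` instance of FACT F-1977 / Nikolov–Segal, proved in the
tree by the operator-Serre route):

* `isTfgProfinite_absoluteGaloisGroup` — `Γ_k` with its Krull topology is a topologically finitely generated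
  profinite group in the sense of `IsTfgProfinite`;
* `tfgProfiniteTopologyUnique_absoluteGaloisGroup` — **F-1275 at `Γ_k`**: any two topologically finitely generated
  profinite group topologies on the abstract group `Γ_k` coincide;
* `eq_krullTopology_of_isTfgProfinite` — hence every such topology IS the Krull topology;
* `isHomeomorph_mulEquiv_absoluteGaloisGroup` — and every ABSTRACT group isomorphism from `Γ_k` onto a
  topologically finitely generated profinite group is a homeomorphism (cf. the tree's
  `exists_galoisContinuousMulEquiv_of_mulEquiv` for the Galois-group-to-Galois-group case).

HONEST FRAMING: OUR kernel proofs of classical statements at `G_k`; the general named fact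
`Literature.GroupTheory.NikolovSegalStatement` is neither used nor claimed; nothing here bears on [IUTchIII]
Cor. 3.12 or asserts that abc is proved or refuted.

## References

* S. Mochizuki, *The geometry of Frobenioids I*, Kyushu J. Math. 62 (2008), Def. 2.8 (i). [MochizukiFrdI2008]
* N. Nikolov, D. Segal, *Finite index subgroups in profinite groups*, C. R. Acad. Sci. 337 (2003), Thm 1.1.
  [NikolovSegal2003]
* J. Neukirch, A. Schmidt, K. Wingberg, *Cohomology of Number Fields* (2008), Thm. 7.5.10.
  [NeukirchSchmidtWingberg2008]
-/

noncomputable section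

namespace Summit.ABC.IUTFork

open Field Literature.AlgebraicGeometry.Frobenioids Literature.AnabelianGeometry.AbsoluteAnabelian

variable (k : Type) [Field k] [ValuativeRel k] [TopologicalSpace k] [IsNonarchimedeanLocalField k] [CharZero k]

/-- **`Γ_k` is a topologically finitely generated profinite group** (`k` a non-archimedean local field of
characteristic `0`), in the sense of the [FrdI] Def. 2.8 structure `IsTfgProfinite`: the Krull topology is a
compact Hausdorff totally disconnected group topology, and a finite subset generates a dense subgroup
(`isTopologicallyFinitelyGenerated_absoluteGaloisGroup_local`). [cite: NeukirchSchmidtWingberg2008, Thm. 7.5.10]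
[cite: MochizukiFrdI2008, Def. 2.8(i) p.52] -/
theorem isTfgProfinite_absoluteGaloisGroup : IsTfgProfinite (absoluteGaloisGroup k) := by
  classical
  obtain ⟨s, hs⟩ := (isTopologicallyFinitelyGenerated_absoluteGaloisGroup_local k).exists_finset
  refine ⟨inferInstance, inferInstance, inferInstance, inferInstance, s, ?_⟩
  rw [dense_iff_closure_eq, ← Subgroup.topologicalClosure_coe, hs, Subgroup.coe_top]

/-- **[FrdI] Def. 2.8 (i) «[uniquely determined]» AT `Γ_k`, unconditionally (FACT-LIST F-1275, instance class
«absolute Galois groups of `p`-adic fields»):** any two topologically finitely generated profinite group topologies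
on the abstract group `Gal(k̄/k)` coincide — the Krull topology is strongly complete
(`forall_finiteIndex_isOpen_absoluteGaloisGroup`), so the bridge
`TfgProfiniteTopologyUnique.of_forall_finiteIndex_isOpen` applies. [cite: MochizukiFrdI2008, Def. 2.8(i) p.52]
[cite: NikolovSegal2003, Thm 1.1] -/
theorem tfgProfiniteTopologyUnique_absoluteGaloisGroup : TfgProfiniteTopologyUnique (absoluteGaloisGroup k) :=
  TfgProfiniteTopologyUnique.of_forall_finiteIndex_isOpen (absoluteGaloisGroup k)
    (isTfgProfinite_absoluteGaloisGroup k) (forall_finiteIndex_isOpen_absoluteGaloisGroup k)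

/-- Consequently every topologically finitely generated profinite group topology on the abstract group `Γ_k`
IS the Krull topology. [cite: MochizukiFrdI2008, Def. 2.8(i) p.52] [cite: NikolovSegal2003, Thm 1.1] -/
theorem eq_krullTopology_of_isTfgProfinite (t : TopologicalSpace (absoluteGaloisGroup k))
    (ht : @IsTfgProfinite (absoluteGaloisGroup k) _ t) :
    t = instTopologicalSpaceAbsoluteGaloisGroup k :=
  tfgProfiniteTopologyUnique_absoluteGaloisGroup k t _ ht (isTfgProfinite_absoluteGaloisGroup k)

/-- **Rigidity of `Γ_k` towards topologically finitely generated profinite groups:** every ABSTRACT group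
isomorphism from `Gal(k̄/k)` onto a topologically finitely generated profinite group `H` is a homeomorphism
(`TfgProfiniteTopologyUnique.isHomeomorph_mulEquiv`). [cite: NikolovSegal2003, Thm 1.1]
[cite: MochizukiFrdI2008, Def. 2.8(i) p.52] -/
theorem isHomeomorph_mulEquiv_absoluteGaloisGroup {H : Type} [Group H] [TopologicalSpace H]
    (hH : IsTfgProfinite H) (φ : absoluteGaloisGroup k ≃* H) : IsHomeomorph φ :=
  (tfgProfiniteTopologyUnique_absoluteGaloisGroup k).isHomeomorph_mulEquiv
    (isTfgProfinite_absoluteGaloisGroup k) hH φ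

/-- In particular every abstract group isomorphism between absolute Galois groups of non-archimedean local
fields of characteristic `0` is a homeomorphism for the Krull topologies (re-derived through F-1275; cf. the
tree's `exists_galoisContinuousMulEquiv_of_mulEquiv`). [cite: NikolovSegal2003, Thm 1.1] -/
theorem isHomeomorph_mulEquiv_absoluteGaloisGroup_absoluteGaloisGroup (k' : Type) [Field k']
    [ValuativeRel k'] [TopologicalSpace k'] [IsNonarchimedeanLocalField k'] [CharZero k']
    (φ : absoluteGaloisGroup k ≃* absoluteGaloisGroup k') : IsHomeomorph φ :=
  isHomeomorph_mulEquiv_absoluteGaloisGroup k (isTfgProfinite_absoluteGaloisGroup k') φ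

end Summit.ABC.IUTFork

end
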